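import Summits.AtomisticToContinuum.FouriersLaw.Theses.OddSectorIrreversibility
import Summits.AtomisticToContinuum.FouriersLaw.Theorems.OddResponseBound.Negative.OddPairing
import Literature.MathematicalPhysics.KineticTheory.LangevinChainGibbs

/-!
# OddResponseBound — the response density is pinned almost everywhere; the bound does not depend on the version of `h`; any refutation proves a `NessUnique` instance

Helper file for item stmt-AtomisticToContinuum-9140 (`OddSectorIrreversibility.OddResponseBound`, "SI":
`N · ∫ (h − h∘Θ)² dμ_{N,T,T} ≤ C` for every `L²` linear-response density `h` of the steady-state family
`δ ↦ μ_{N,T+δ/2,T−δ/2}`). Sorry-free, no new definitions. Shape facts and a refutation template used by both lanes of the item: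

* `ae_eq_of_integral_mul_contDiff_eq`, `responseDensity_ae_eq` — the `∀ h` of the crux hides no freedom:
  two `L²(μ)` functions with the same pairings against all smooth compactly supported observables agree
  `μ`-a.e. (Mathlib's `ae_eq_of_integral_contDiff_smul_eq` on the finite-dimensional phase space), hence two
  functions satisfying clause 2 of the response-density predicate (limits along `𝓝[≠] 0` are unique) are
  versions of one another.
* `measurePreserving_momentumReversal_gibbsMeasure` (every chain: `H` is even in `p`),
  `family_self_eq_gibbsMeasure` (under the uniqueness antecedent the equal-temperature member of ANY
  steady-state family is the Gibbs measure, `pinnedChain_isSteadyState_gibbsMeasure`) and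
  `oddResponse_conclusion_indep` — consequently SI's conclusion
  `MemLp (h − h∘Θ) 2 μ_T ∧ N ∫ (h − h∘Θ)² dμ_T ≤ C` takes the same truth value on all versions
  (`Θ` preserves `μ_T`, so `h ∘ Θ` is also determined a.e.).
* `tendsto_oddAsymmetry` — the dictionary behind every witness-based floor: under the same antecedent,
  for every smooth compactly supported `F`, `(μ_δ(F) − μ_δ(F∘Θ))/δ → ∫ F (h − h∘Θ) dμ_T`
  (`μ_δ := μ_{N,T+δ/2,T−δ/2}`): SI's `h − h∘Θ` is the linear response of the momentum-reversal
  asymmetries of the nonequilibrium state, so (`OddPairing.four_mul_sq_integral_le`) any observables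
  `F_N` with `N (lim ⟨F_N − F_N∘Θ⟩_δ/δ)² / ∫ F_N² → ∞` refute SI.
* `oddResponseBound_false_of_asymmetryWitness` — refutation template in NESS language (dual to
  `Negative/EchoFloor.lean`, which speaks of the Kubo corrector): at a parameter point with weak-NESS
  uniqueness, response densities along a family at `T` (an instance of `ResponseDensity`) plus
  asymmetry witnesses `F_N` (`C ∫ F_N² < N r_N²`, `r_N ≤ |μ_δ(F_N − F_N∘Θ)|/|δ|` for small `δ ≠ 0`, every `C`)
  give `¬ OddResponseBound`. No semigroup, no corrector, no `OddDensityIsCorrector` needed on this side.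
* `nessUnique_instance_of_not_oddResponseBound` — the formal shield: `¬ SI` PROVES weak-NESS uniqueness
  for some parameter point (all `N`, `T_L`, `T_R > 0`), i.e. an instance of item `NessUnique`
  (stmt-AtomisticToContinuum-0741); dually SI holds outright wherever that antecedent fails, so the
  item can close in neither direction before the uniqueness question is settled in tree.
Nothing here closes an item.
-/

noncomputable section

open MeasureTheory Filter Topology Set
open Literature.MathematicalPhysics.KineticTheory.HeatConduction
open Summit.AtomisticToContinuum.FouriersLaw.Theses.OddSectorIrreversibility
open Summit.AtomisticToContinuum.FouriersLaw.Theorems.OddResponseBound.Negative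

namespace Summit.AtomisticToContinuum.FouriersLaw.Theorems.OddResponseBound.DensityUnique

/-! ## §1 smooth compactly supported observables pin an `L²` density -/

section Pin

variable {N : ℕ}

/-- Two square-integrable functions on phase space with a finite measure `μ` that have the same
pairing `∫ F h dμ` with every smooth compactly supported `F` agree `μ`-a.e. (distributions that vanish
vanish as functions; Mathlib `ae_eq_of_integral_contDiff_smul_eq`). [folklore] -/
theorem ae_eq_of_integral_mul_contDiff_eq {μ : Measure (PhaseSpace N)} [IsFiniteMeasure μ]
    {h h' : PhaseSpace N → ℝ} (hh : MemLp h 2 μ) (hh' : MemLp h' 2 μ)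
    (H : ∀ F : PhaseSpace N → ℝ, ContDiff ℝ ((⊤ : ℕ∞) : WithTop ℕ∞) F → HasCompactSupport F →
      ∫ x, F x * h x ∂μ = ∫ x, F x * h' x ∂μ) :
    h =ᵐ[μ] h' := by
  have hi : LocallyIntegrable h μ := (hh.integrable one_le_two).locallyIntegrable
  have hi' : LocallyIntegrable h' μ := (hh'.integrable one_le_two).locallyIntegrable
  exact ae_eq_of_integral_contDiff_smul_eq hi hi'
    (fun g hg hgs => by simpa only [smul_eq_mul] using H g hg hgs)

/-- **The response density is pinned a.e.** If `h, h' ∈ L²(μ₀)` both satisfy clause 2 of the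
response-density predicate of `OddResponseBound` / `ResponseDensity` — the same difference quotients
`Q F` converge along a proper filter `l` (there: `𝓝[≠] 0`) to `∫ F h dμ₀`, resp. `∫ F h' dμ₀`, for every
smooth compactly supported `F` — then `h = h'` `μ₀`-a.e. [folklore] -/
theorem responseDensity_ae_eq {μ₀ : Measure (PhaseSpace N)} [IsFiniteMeasure μ₀]
    {l : Filter ℝ} [NeBot l] {Q : (PhaseSpace N → ℝ) → ℝ → ℝ}
    {h h' : PhaseSpace N → ℝ} (hh : MemLp h 2 μ₀) (hh' : MemLp h' 2 μ₀)
    (hF : ∀ F : PhaseSpace N → ℝ, ContDiff ℝ ((⊤ : ℕ∞) : WithTop ℕ∞) F → HasCompactSupport F →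
      Tendsto (Q F) l (𝓝 (∫ x, F x * h x ∂μ₀)))
    (hF' : ∀ F : PhaseSpace N → ℝ, ContDiff ℝ ((⊤ : ℕ∞) : WithTop ℕ∞) F → HasCompactSupport F →
      Tendsto (Q F) l (𝓝 (∫ x, F x * h' x ∂μ₀))) :
    h =ᵐ[μ₀] h' :=
  ae_eq_of_integral_mul_contDiff_eq hh hh' fun F hFd hFs =>
    tendsto_nhds_unique (hF F hFd hFs) (hF' F hFd hFs)

end Pin

/-! ## §2 the conclusion of SI does not depend on the version of `h` -/

section Indep

variable {N : ℕ}

/-- The Gibbs measure of ANY oscillator chain is invariant under momentum reversal `(q,p) ↦ (q,−p)`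
(the energy is even in the momenta; Lebesgue measure is `Θ`-invariant; tilting by a `Θ`-invariant
density preserves invariance). [folklore] -/
theorem measurePreserving_momentumReversal_gibbsMeasure (P : OscillatorChain) (N : ℕ) (T : ℝ) :
    MeasurePreserving (momentumReversal N) (P.gibbsMeasure N T) (P.gibbsMeasure N T) :=
  OddPairing.measurePreserving_tilted (measurePreserving_momentumReversal N)
    (momentumReversal N).measurableEmbedding
    (fun x => by rw [momentumReversal_apply, OscillatorChain.hamiltonian_neg_momentum])

/-- If `h = h'` a.e. for a momentum-reversal-invariant measure, then also `h∘Θ = h'∘Θ` a.e., so the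
odd parts agree a.e.: `h − h∘Θ = h' − h'∘Θ` a.e. [folklore] -/
theorem oddPart_ae_eq {μ : Measure (PhaseSpace N)}
    (hΘ : MeasurePreserving (momentumReversal N) μ μ) {h h' : PhaseSpace N → ℝ} (hae : h =ᵐ[μ] h') :
    (fun x => h x - h (x.1, -x.2)) =ᵐ[μ] fun x => h' x - h' (x.1, -x.2) := by
  have h2 : (fun x => h (momentumReversal N x)) =ᵐ[μ] fun x => h' (momentumReversal N x) :=
    hΘ.quasiMeasurePreserving.ae_eq_comp hae
  filter_upwards [hae, h2] with x hx hx2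
  simp only [momentumReversal_apply] at hx2
  rw [hx, hx2]

/-- Version-independence of SI's conclusion: for a momentum-reversal-invariant measure and `h = h'`
a.e., `MemLp (h − h∘Θ) 2 μ ∧ N ∫ (h − h∘Θ)² dμ ≤ C` holds for `h` iff it holds for `h'`. [folklore] -/
theorem oddResponse_conclusion_congr {μ : Measure (PhaseSpace N)}
    (hΘ : MeasurePreserving (momentumReversal N) μ μ) {h h' : PhaseSpace N → ℝ} (hae : h =ᵐ[μ] h')
    (C : ℝ) :
    (MemLp (fun x => h x - h (x.1, -x.2)) 2 μ ∧
        (N : ℝ) * ∫ x, (h x - h (x.1, -x.2)) ^ 2 ∂μ ≤ C) ↔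
      (MemLp (fun x => h' x - h' (x.1, -x.2)) 2 μ ∧
        (N : ℝ) * ∫ x, (h' x - h' (x.1, -x.2)) ^ 2 ∂μ ≤ C) := by
  have hodd := oddPart_ae_eq hΘ hae
  have hint : ∫ x, (h x - h (x.1, -x.2)) ^ 2 ∂μ = ∫ x, (h' x - h' (x.1, -x.2)) ^ 2 ∂μ := by
    refine integral_congr_ae ?_
    filter_upwards [hodd] with x hx
    rw [hx]
  rw [memLp_congr_ae hodd, hint]

variable {ω₂ lam β γ : ℝ}

/-- Under the uniqueness antecedent of the crux, the equal-temperature member `μ N T T` (`T > 0`) of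
ANY steady-state family of `pinnedChain ω₂ lam β γ` (all parameters `> 0`) is the Gibbs measure
(`pinnedChain_isSteadyState_gibbsMeasure`). [folklore] -/
theorem family_self_eq_gibbsMeasure (hω : 0 < ω₂) (hl : 0 < lam) (hβ : 0 < β)
    (hUq : ∀ (N : ℕ) (T_L T_R : ℝ), 0 < T_L → 0 < T_R → ∀ μ ν : Measure (PhaseSpace N),
      (pinnedChain ω₂ lam β γ).IsSteadyState N T_L T_R μ →
      (pinnedChain ω₂ lam β γ).IsSteadyState N T_L T_R ν → μ = ν)
    {μ : (N : ℕ) → ℝ → ℝ → Measure (PhaseSpace N)}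
    (hμ : ∀ (N : ℕ) (T_L T_R : ℝ), 0 < T_L → 0 < T_R →
      (pinnedChain ω₂ lam β γ).IsSteadyState N T_L T_R (μ N T_L T_R))
    (N : ℕ) {T : ℝ} (hT : 0 < T) :
    μ N T T = (pinnedChain ω₂ lam β γ).gibbsMeasure N T :=
  hUq N T T hT hT _ _ (hμ N T T hT hT) (pinnedChain_isSteadyState_gibbsMeasure hω hl.le hβ.le γ N hT)

/-- **SI's conclusion is the same on every version of the response density.** Under the uniqueness
antecedent, along any steady-state family `μ` and at any `T > 0`, `N`: if `h, h' ∈ L²(μ_{N,T,T})` both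
satisfy clause 2 of the response-density predicate (smooth compactly supported observables), then
`MemLp (h − h∘Θ) 2 ∧ N ∫ (h − h∘Θ)² ≤ C` holds for `h` iff for `h'` — `μ_{N,T,T}` is the Gibbs
measure, which momentum reversal preserves, and `h = h'` a.e. So the universally quantified `h` of
`OddResponseBound` carries no junk freedom. [folklore] -/
theorem oddResponse_conclusion_indep (hω : 0 < ω₂) (hl : 0 < lam) (hβ : 0 < β)
    (hUq : ∀ (N : ℕ) (T_L T_R : ℝ), 0 < T_L → 0 < T_R → ∀ μ ν : Measure (PhaseSpace N),
      (pinnedChain ω₂ lam β γ).IsSteadyState N T_L T_R μ →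
      (pinnedChain ω₂ lam β γ).IsSteadyState N T_L T_R ν → μ = ν)
    {μ : (N : ℕ) → ℝ → ℝ → Measure (PhaseSpace N)}
    (hμ : ∀ (N : ℕ) (T_L T_R : ℝ), 0 < T_L → 0 < T_R →
      (pinnedChain ω₂ lam β γ).IsSteadyState N T_L T_R (μ N T_L T_R))
    {T : ℝ} (hT : 0 < T) {N : ℕ} {h h' : PhaseSpace N → ℝ}
    (hh : MemLp h 2 (μ N T T)) (hh' : MemLp h' 2 (μ N T T))
    (hF : ∀ F : PhaseSpace N → ℝ, ContDiff ℝ ((⊤ : ℕ∞) : WithTop ℕ∞) F → HasCompactSupport F →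
      Tendsto (fun δ : ℝ => ((∫ x, F x ∂(μ N (T + δ / 2) (T - δ / 2))) - ∫ x, F x ∂(μ N T T)) / δ)
        (𝓝[≠] 0) (𝓝 (∫ x, F x * h x ∂(μ N T T))))
    (hF' : ∀ F : PhaseSpace N → ℝ, ContDiff ℝ ((⊤ : ℕ∞) : WithTop ℕ∞) F → HasCompactSupport F →
      Tendsto (fun δ : ℝ => ((∫ x, F x ∂(μ N (T + δ / 2) (T - δ / 2))) - ∫ x, F x ∂(μ N T T)) / δ)
        (𝓝[≠] 0) (𝓝 (∫ x, F x * h' x ∂(μ N T T))))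
    (C : ℝ) :
    (MemLp (fun x => h x - h (x.1, -x.2)) 2 (μ N T T) ∧
        (N : ℝ) * ∫ x, (h x - h (x.1, -x.2)) ^ 2 ∂(μ N T T) ≤ C) ↔
      (MemLp (fun x => h' x - h' (x.1, -x.2)) 2 (μ N T T) ∧
        (N : ℝ) * ∫ x, (h' x - h' (x.1, -x.2)) ^ 2 ∂(μ N T T) ≤ C) := by
  have hG := family_self_eq_gibbsMeasure (γ := γ) hω hl hβ hUq hμ N hT
  haveI : IsProbabilityMeasure (μ N T T) := (hμ N T T hT hT).1
  have hΘ : MeasurePreserving (momentumReversal N) (μ N T T) (μ N T T) := by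
    rw [hG]; exact measurePreserving_momentumReversal_gibbsMeasure _ N T
  exact oddResponse_conclusion_congr hΘ (responseDensity_ae_eq hh hh' hF hF') C


/-! ## §2b the dictionary: odd NESS asymmetries of smooth observables are pairings with `h − h∘Θ` -/

/-- `F ∘ Θ` is as smooth as `F` (`Θ (q,p) = (q,−p)` is linear). [folklore] -/
theorem contDiff_comp_momentumReversal {F : PhaseSpace N → ℝ} {n : WithTop ℕ∞}
    (hF : ContDiff ℝ n F) : ContDiff ℝ n (fun x : PhaseSpace N => F (x.1, -x.2)) :=
  hF.comp (contDiff_fst.prodMk contDiff_snd.neg)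

/-- `F ∘ Θ` is compactly supported if `F` is (`Θ` is a homeomorphism). [folklore] -/
theorem hasCompactSupport_comp_momentumReversal {F : PhaseSpace N → ℝ} (hF : HasCompactSupport F) :
    HasCompactSupport (fun x : PhaseSpace N => F (x.1, -x.2)) :=
  hF.comp_homeomorph ((Homeomorph.refl (Fin N → ℝ)).prodCongr (Homeomorph.neg (Fin N → ℝ)))

/-- A smooth compactly supported observable paired with an `L²` function on a finite measure space is
integrable. [folklore] -/
theorem integrable_contDiff_mul {μ : Measure (PhaseSpace N)} [IsFiniteMeasure μ]
    {F h : PhaseSpace N → ℝ} (hFd : ContDiff ℝ ((⊤ : ℕ∞) : WithTop ℕ∞) F) (hFs : HasCompactSupport F)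
    (hh : MemLp h 2 μ) : Integrable (fun x => F x * h x) μ := by
  obtain ⟨c, hc⟩ := hFd.continuous.bounded_above_of_compact_support hFs
  exact (hh.integrable one_le_two).bdd_mul hFd.continuous.aestronglyMeasurable
    (Eventually.of_forall hc)

/-- **Odd NESS asymmetries are pairings with the odd part of the response density.** Under the
uniqueness antecedent, along a steady-state family `μ` of `pinnedChain ω₂ lam β γ` (all `> 0`), if
`h ∈ L²(μ_{N,T,T})` satisfies clause 2 of the response-density predicate, then for every smooth
compactly supported observable `F`
`(μ_{N,T+δ/2,T−δ/2}(F) − μ_{N,T+δ/2,T−δ/2}(F∘Θ))/δ → ∫ F · (h − h∘Θ) dμ_{N,T,T}` (`δ → 0`, `δ ≠ 0`):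
the odd part `h − h∘Θ` measured by SI is exactly the linear response of the momentum-reversal
ASYMMETRIES `⟨F − F∘Θ⟩_δ` of the nonequilibrium state (`μ_{N,T,T}` = Gibbs is `Θ`-invariant, so these
vanish at `δ = 0`; `Θ`-transfer `∫ (F∘Θ) h = ∫ F (h∘Θ)`). With the pairing inequality
(`OddPairing.four_mul_sq_integral_le`) every such `F` gives the floor
`(lim ⟨F − F∘Θ⟩_δ/δ)² ≤ ∫ F² · ∫ (h − h∘Θ)²`. [folklore] -/
theorem tendsto_oddAsymmetry (hω : 0 < ω₂) (hl : 0 < lam) (hβ : 0 < β)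
    (hUq : ∀ (N : ℕ) (T_L T_R : ℝ), 0 < T_L → 0 < T_R → ∀ μ ν : Measure (PhaseSpace N),
      (pinnedChain ω₂ lam β γ).IsSteadyState N T_L T_R μ →
      (pinnedChain ω₂ lam β γ).IsSteadyState N T_L T_R ν → μ = ν)
    {μ : (N : ℕ) → ℝ → ℝ → Measure (PhaseSpace N)}
    (hμ : ∀ (N : ℕ) (T_L T_R : ℝ), 0 < T_L → 0 < T_R →
      (pinnedChain ω₂ lam β γ).IsSteadyState N T_L T_R (μ N T_L T_R))
    {T : ℝ} (hT : 0 < T) {N : ℕ} {h : PhaseSpace N → ℝ} (hh : MemLp h 2 (μ N T T))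
    (hF : ∀ F : PhaseSpace N → ℝ, ContDiff ℝ ((⊤ : ℕ∞) : WithTop ℕ∞) F → HasCompactSupport F →
      Tendsto (fun δ : ℝ => ((∫ x, F x ∂(μ N (T + δ / 2) (T - δ / 2))) - ∫ x, F x ∂(μ N T T)) / δ)
        (𝓝[≠] 0) (𝓝 (∫ x, F x * h x ∂(μ N T T))))
    {F : PhaseSpace N → ℝ} (hFd : ContDiff ℝ ((⊤ : ℕ∞) : WithTop ℕ∞) F) (hFs : HasCompactSupport F) :
    Tendsto (fun δ : ℝ => ((∫ x, F x ∂(μ N (T + δ / 2) (T - δ / 2))) -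
        ∫ x, F (x.1, -x.2) ∂(μ N (T + δ / 2) (T - δ / 2))) / δ)
      (𝓝[≠] 0) (𝓝 (∫ x, F x * (h x - h (x.1, -x.2)) ∂(μ N T T))) := by
  have hG := family_self_eq_gibbsMeasure (γ := γ) hω hl hβ hUq hμ N hT
  haveI : IsProbabilityMeasure (μ N T T) := (hμ N T T hT hT).1
  have hΘ : MeasurePreserving (momentumReversal N) (μ N T T) (μ N T T) := by
    rw [hG]; exact measurePreserving_momentumReversal_gibbsMeasure _ N T
  have h1 := hF F hFd hFs
  have h2 := hF _ (contDiff_comp_momentumReversal hFd) (hasCompactSupport_comp_momentumReversal hFs)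
  -- `μ_T` is `Θ`-invariant: `∫ F∘Θ dμ_T = ∫ F dμ_T`
  have hinv : ∫ x, F (x.1, -x.2) ∂(μ N T T) = ∫ x, F x ∂(μ N T T) := by
    simpa only [momentumReversal_apply] using hΘ.integral_comp' (f := momentumReversal N) F
  -- Θ-transfer: `∫ (F∘Θ) h dμ_T = ∫ F (h∘Θ) dμ_T`
  have htr : ∫ x, F (x.1, -x.2) * h x ∂(μ N T T) = ∫ x, F x * h (x.1, -x.2) ∂(μ N T T) := by
    have key := hΘ.integral_comp' (f := momentumReversal N) (fun x => F (x.1, -x.2) * h x)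
    simpa only [momentumReversal_apply, neg_neg] using key.symm
  have h3 := h1.sub h2
  have hfun : (fun δ : ℝ => ((∫ x, F x ∂(μ N (T + δ / 2) (T - δ / 2))) - ∫ x, F x ∂(μ N T T)) / δ -
      ((∫ x, F (x.1, -x.2) ∂(μ N (T + δ / 2) (T - δ / 2))) - ∫ x, F (x.1, -x.2) ∂(μ N T T)) / δ) =
      fun δ : ℝ => ((∫ x, F x ∂(μ N (T + δ / 2) (T - δ / 2))) -
        ∫ x, F (x.1, -x.2) ∂(μ N (T + δ / 2) (T - δ / 2))) / δ := by
    funext δ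
    rw [hinv]
    ring
  have hlim : ∫ x, F x * h x ∂(μ N T T) - ∫ x, F (x.1, -x.2) * h x ∂(μ N T T) =
      ∫ x, F x * (h x - h (x.1, -x.2)) ∂(μ N T T) := by
    have hhΘ : MemLp (fun x : PhaseSpace N => h (x.1, -x.2)) 2 (μ N T T) := by
      simpa only [Function.comp_def, momentumReversal_apply] using hh.comp_measurePreserving hΘ
    rw [htr, ← integral_sub (integrable_contDiff_mul hFd hFs hh) (integrable_contDiff_mul hFd hFs hhΘ)]
    refine integral_congr_ae (Eventually.of_forall fun x => ?_)
    ring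
  rw [hfun, hlim] at h3
  exact h3

end Indep

/-! ## §2c refutation template in NESS language: asymmetry witnesses -/

section Witness

variable {ω₂ lam β γ : ℝ}

/-- **Refutation template (NESS form).** Fix parameters `> 0` at which weak-NESS uniqueness holds, a
steady-state family `μ`, and `T > 0` such that response densities exist along `μ` at `T` for all
`N ≥ 2` (an instance of item `ResponseDensity`). If for every `C` there are `N ≥ 2`, a smooth compactly
supported observable `F` on the `N`-chain and `r ≥ 0` with `C · ∫ F² dμ_{N,T,T} < N r²` and
`r ≤ |μ_δ(F) − μ_δ(F∘Θ)|/|δ|` for all small `δ ≠ 0` (`μ_δ := μ_{N,T+δ/2,T−δ/2}`) — an ASYMMETRY WITNESS: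
normalised momentum-reversal asymmetry of the NESS `≫ N^{-1/2}` to first order — then `OddResponseBound`
is false: by `tendsto_oddAsymmetry` the asymmetry quotient tends to `∫ F (h − h∘Θ) dμ_T`, and
Cauchy–Schwarz (`OddPairing.sq_integral_mul_le`) gives `N r² ≤ ∫ F² · N ∫ (h − h∘Θ)² ≤ C ∫ F²`.
(Heuristic witness for the deterministic chain, Disproof.lean §3: a smooth truncation of the windowed
transport `∫_{−bN}^{bN} J_bulk∘Φ_s ds`, `∫ F² ≍ N²`, asymmetry `≍ N δ`.) [folklore] -/
theorem oddResponseBound_false_of_asymmetryWitness (hω : 0 < ω₂) (hl : 0 < lam) (hβ : 0 < β)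
    (hγ : 0 < γ)
    (hUq : ∀ (N : ℕ) (T_L T_R : ℝ), 0 < T_L → 0 < T_R → ∀ μ ν : Measure (PhaseSpace N),
      (pinnedChain ω₂ lam β γ).IsSteadyState N T_L T_R μ →
      (pinnedChain ω₂ lam β γ).IsSteadyState N T_L T_R ν → μ = ν)
    {μ : (N : ℕ) → ℝ → ℝ → Measure (PhaseSpace N)}
    (hμ : ∀ (N : ℕ) (T_L T_R : ℝ), 0 < T_L → 0 < T_R →
      (pinnedChain ω₂ lam β γ).IsSteadyState N T_L T_R (μ N T_L T_R))
    {T : ℝ} (hT : 0 < T)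
    (hR : ∀ N : ℕ, 2 ≤ N → ∃ h : PhaseSpace N → ℝ, MemLp h 2 (μ N T T) ∧
      (∀ F : PhaseSpace N → ℝ, ContDiff ℝ ((⊤ : ℕ∞) : WithTop ℕ∞) F → HasCompactSupport F →
        Tendsto (fun δ : ℝ => ((∫ x, F x ∂(μ N (T + δ / 2) (T - δ / 2))) - ∫ x, F x ∂(μ N T T)) / δ)
          (𝓝[≠] 0) (𝓝 (∫ x, F x * h x ∂(μ N T T)))) ∧
      (∀ i : Fin N, Tendsto (fun δ : ℝ =>
          ((∫ x, (pinnedChain ω₂ lam β γ).bondCurrent N i x ∂(μ N (T + δ / 2) (T - δ / 2))) -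
            ∫ x, (pinnedChain ω₂ lam β γ).bondCurrent N i x ∂(μ N T T)) / δ)
          (𝓝[≠] 0) (𝓝 (∫ x, (pinnedChain ω₂ lam β γ).bondCurrent N i x * h x ∂(μ N T T)))))
    (hW : ∀ C : ℝ, ∃ N : ℕ, 2 ≤ N ∧ ∃ F : PhaseSpace N → ℝ,
      ContDiff ℝ ((⊤ : ℕ∞) : WithTop ℕ∞) F ∧ HasCompactSupport F ∧ ∃ r : ℝ, 0 ≤ r ∧
        C * ∫ x, F x ^ 2 ∂(μ N T T) < N * r ^ 2 ∧
        ∀ᶠ δ in 𝓝[≠] (0 : ℝ), r ≤ |((∫ x, F x ∂(μ N (T + δ / 2) (T - δ / 2))) -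
          ∫ x, F (x.1, -x.2) ∂(μ N (T + δ / 2) (T - δ / 2))) / δ|) :
    ¬ OddResponseBound := by
  intro hSI
  obtain ⟨C, hC⟩ := hSI ω₂ lam β γ hω hl hβ hγ hUq μ hμ T hT
  obtain ⟨N, hN2, F, hFd, hFs, r, hr0, hlt, hev⟩ := hW C
  obtain ⟨h, hh, hF, hcur⟩ := hR N hN2
  obtain ⟨hmem, hbound⟩ := hC N h hN2 ⟨hh, hF, hcur⟩
  haveI : IsProbabilityMeasure (μ N T T) := (hμ N T T hT hT).1
  -- the asymmetry quotient tends to the pairing with the odd part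
  have hlim := tendsto_oddAsymmetry (γ := γ) hω hl hβ hUq hμ hT hh hF hFd hFs
  set L := ∫ x, F x * (h x - h (x.1, -x.2)) ∂(μ N T T) with hL
  have habs : Tendsto (fun δ : ℝ => |((∫ x, F x ∂(μ N (T + δ / 2) (T - δ / 2))) -
      ∫ x, F (x.1, -x.2) ∂(μ N (T + δ / 2) (T - δ / 2))) / δ|) (𝓝[≠] 0) (𝓝 |L|) :=
    (continuous_abs.tendsto L).comp hlim
  have hrL : r ≤ |L| := ge_of_tendsto habs hev
  -- `F ∈ L²(μ_T)` (bounded, compactly supported, finite measure)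
  obtain ⟨c, hc⟩ := hFd.continuous.bounded_above_of_compact_support hFs
  have hF2 : MemLp F 2 (μ N T T) :=
    (memLp_top_of_bound hFd.continuous.aestronglyMeasurable c (Eventually.of_forall hc)).mono_exponent
      le_top
  -- Cauchy–Schwarz: L² ≤ ∫ F² · ∫ (h − h∘Θ)²
  have hcs := OddPairing.sq_integral_mul_le hF2 hmem
  have hF2nn : 0 ≤ ∫ x, F x ^ 2 ∂(μ N T T) := integral_nonneg fun x => sq_nonneg _
  have hN0 : (0 : ℝ) ≤ N := Nat.cast_nonneg N
  have h1 : r ^ 2 ≤ L ^ 2 := by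
    rw [← sq_abs L]
    exact pow_le_pow_left₀ hr0 hrL 2
  have h2 : (N : ℝ) * r ^ 2 ≤ C * ∫ x, F x ^ 2 ∂(μ N T T) :=
    calc (N : ℝ) * r ^ 2 ≤ N * L ^ 2 := mul_le_mul_of_nonneg_left h1 hN0
      _ ≤ N * ((∫ x, F x ^ 2 ∂(μ N T T)) * ∫ x, (h x - h (x.1, -x.2)) ^ 2 ∂(μ N T T)) :=
          mul_le_mul_of_nonneg_left hcs hN0
      _ = (∫ x, F x ^ 2 ∂(μ N T T)) * ((N : ℝ) * ∫ x, (h x - h (x.1, -x.2)) ^ 2 ∂(μ N T T)) := by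
          ring
      _ ≤ (∫ x, F x ^ 2 ∂(μ N T T)) * C := mul_le_mul_of_nonneg_left hbound hF2nn
      _ = C * ∫ x, F x ^ 2 ∂(μ N T T) := mul_comm _ _
  linarith

end Witness

/-! ## §3 the formal shield: closing the item either way needs the uniqueness question settled -/

/-- **Any refutation of SI proves an instance of `NessUnique`.** `¬ OddResponseBound` yields parameters
`ω₂, lam, β, γ > 0` at which weak-NESS uniqueness (`IsSteadyState` class) holds for ALL `N` and all
`T_L, T_R > 0` — the content of item `NessUnique` (stmt-AtomisticToContinuum-0741) at that point. So no
`¬ SI` can land before such an instance is in the tree. [folklore] -/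
theorem nessUnique_instance_of_not_oddResponseBound (hn : ¬ OddResponseBound) :
    ∃ ω₂ lam β γ : ℝ, 0 < ω₂ ∧ 0 < lam ∧ 0 < β ∧ 0 < γ ∧
      ∀ (N : ℕ) (T_L T_R : ℝ), 0 < T_L → 0 < T_R → ∀ μ ν : Measure (PhaseSpace N),
        (pinnedChain ω₂ lam β γ).IsSteadyState N T_L T_R μ →
        (pinnedChain ω₂ lam β γ).IsSteadyState N T_L T_R ν → μ = ν := by
  by_contra hne
  exact hn fun ω₂ lam β γ hω hl hβ hγ hU => (hne ⟨ω₂, lam, β, γ, hω, hl, hβ, hγ, hU⟩).elim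

end Summit.AtomisticToContinuum.FouriersLaw.Theorems.OddResponseBound.DensityUnique
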